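import Mathlib

/-!
# `HyperbolicEnd` (stmt-SmoothPoincare4-7825), line `Sketch`, negative side — product rule for the curvature numerator

Helper for the native frozen-`J` refutation of the flat certificate filling stub on `ℝ⁴`
(tree dir `Theorems/HyperbolicEnd/Negative/`). Statement registered on the crux item
(stub helper_frozen_productRule).

**The identity.** For real functions `a`, `m` on `ℂ` of class `C²` at `z`, the curvature
numerator `λ Δλ - |∇λ|²` of the product density `λ = a · m` splits as
`(a m) Δ(a m) - |∇(a m)|² = m² (a Δa - |∇a|²) + a² (m Δm - |∇m|²)` at `z`,
where `|∇f|² = (Df(z) 1)² + (Df(z) I)²` and `Δ` is Mathlib's Laplacian on `ℂ = ℝ²`.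

**The computation.** Near `z` both factors are differentiable, so
`D(a m) = a • Dm + m • Da` on a neighbourhood of `z` (`fderiv_fun_mul`); differentiating once
more at `z` (`fderiv_fun_smul`) gives
`D²(a m)(z)[v, v] = a D²m[v, v] + Da v · Dm v + m D²a[v, v] + Dm v · Da v`.
With `Δf(z) = D²f(z)[1, 1] + D²f(z)[I, I]`
(`InnerProductSpace.laplacian_eq_iteratedFDeriv_complexPlane`, `iteratedFDeriv_two_apply`) the
cross terms `2 a m (Da 1 · Dm 1 + Da I · Dm I)` cancel against those of `|∇(a m)|²` and the
identity is exact algebra (`ring`).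
-/

noncomputable section

-- the prescribed namespace `Summit.<P>.<Sub>.…` duplicates `SmoothPoincare4` (P = Sub)
set_option linter.dupNamespace false

open scoped ContDiff Topology Real
open Laplacian Set Filter Metric Complex

namespace Summit.SmoothPoincare4.SmoothPoincare4.Theorems.HyperbolicEnd.Negative

/-! ### The Laplacian on `ℂ` in the coordinates `1, I` -/

/-- On `ℂ = ℝ²`, `Δf(z) = D²f(z)[1, 1] + D²f(z)[I, I]` with `D²f = D(Df)`. -/
private theorem laplacian_eq_fderiv_fderiv (f : ℂ → ℝ) (z : ℂ) :
    (Δ f) z = fderiv ℝ (fderiv ℝ f) z 1 1 + fderiv ℝ (fderiv ℝ f) z I I := by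
  rw [InnerProductSpace.laplacian_eq_iteratedFDeriv_complexPlane f]
  simp [iteratedFDeriv_two_apply]

/-! ### First and second derivatives of a product -/

/-- **Product rule, to second order.** For `a`, `m` of class `C²` at `z`:
`D(a m)(z) = a(z) • Dm(z) + m(z) • Da(z)` and
`D²(a m)(z) = a(z) • D²m(z) + Da(z) ⊗ Dm(z) + (m(z) • D²a(z) + Dm(z) ⊗ Da(z))`
(as continuous linear maps `ℂ →L[ℝ] ℂ →L[ℝ] ℝ`, `(L ⊗ L') v = L v • L'`). -/
private theorem fderiv_fderiv_mul {a m : ℂ → ℝ} {z : ℂ} (ha : ContDiffAt ℝ 2 a z)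
    (hm : ContDiffAt ℝ 2 m z) :
    fderiv ℝ (fun w => a w * m w) z = a z • fderiv ℝ m z + m z • fderiv ℝ a z ∧
      fderiv ℝ (fderiv ℝ (fun w => a w * m w)) z =
        a z • fderiv ℝ (fderiv ℝ m) z + (fderiv ℝ a z).smulRight (fderiv ℝ m z) +
          (m z • fderiv ℝ (fderiv ℝ a) z + (fderiv ℝ m z).smulRight (fderiv ℝ a z)) := by
  -- both factors are `C²` near `z`, hence differentiable near `z`
  have hae : ∀ᶠ y in 𝓝 z, ContDiffAt ℝ 2 a y := ha.eventually (by simp)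
  have hme : ∀ᶠ y in 𝓝 z, ContDiffAt ℝ 2 m y := hm.eventually (by simp)
  have hda : DifferentiableAt ℝ a z := ha.differentiableAt two_ne_zero
  have hdm : DifferentiableAt ℝ m z := hm.differentiableAt two_ne_zero
  have hDa : DifferentiableAt ℝ (fderiv ℝ a) z :=
    (ha.fderiv_right (m := 1) (by norm_num)).differentiableAt one_ne_zero
  have hDm : DifferentiableAt ℝ (fderiv ℝ m) z :=
    (hm.fderiv_right (m := 1) (by norm_num)).differentiableAt one_ne_zero
  -- the first-order product rule holds on a neighbourhood of `z`
  have h1 : fderiv ℝ (fun w => a w * m w) =ᶠ[𝓝 z]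
      fun y => a y • fderiv ℝ m y + m y • fderiv ℝ a y := by
    filter_upwards [hae, hme] with y hay hmy
    exact fderiv_fun_mul (hay.differentiableAt two_ne_zero) (hmy.differentiableAt two_ne_zero)
  refine ⟨h1.eq_of_nhds, ?_⟩
  rw [h1.fderiv_eq, fderiv_fun_add (hda.fun_smul hDm) (hdm.fun_smul hDa),
    fderiv_fun_smul hda hDm, fderiv_fun_smul hdm hDa]

/-! ### The helper -/

/-- helper (T1): **product rule for the curvature numerator.**  For real functions `a`, `m` on
`ℂ` of class `C²` at `z`, the density `λ = a · m` satisfies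
`λ Δλ - |∇λ|² = m² (a Δa - |∇a|²) + a² (m Δm - |∇m|²)` at `z`
(with `|∇f|² = (Df(z) 1)² + (Df(z) I)²`): the cross terms of `Δ(a m) = m Δa + 2 ∇a·∇m + a Δm`
and `∇(a m) = m ∇a + a ∇m` cancel. -/
theorem helper_frozen_productRule : ∀ (a m : ℂ → ℝ) (z : ℂ), ContDiffAt ℝ 2 a z →
    ContDiffAt ℝ 2 m z →
    (a z * m z) * (Δ (fun w => a w * m w)) z -
        ((fderiv ℝ (fun w => a w * m w) z 1) ^ 2 +
          (fderiv ℝ (fun w => a w * m w) z Complex.I) ^ 2) =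
      (m z) ^ 2 * (a z * (Δ a) z - ((fderiv ℝ a z 1) ^ 2 + (fderiv ℝ a z Complex.I) ^ 2)) +
        (a z) ^ 2 * (m z * (Δ m) z -
          ((fderiv ℝ m z 1) ^ 2 + (fderiv ℝ m z Complex.I) ^ 2)) := by
  intro a m z ha hm
  obtain ⟨h1, h2⟩ := fderiv_fderiv_mul ha hm
  rw [laplacian_eq_fderiv_fderiv (fun w => a w * m w), laplacian_eq_fderiv_fderiv a,
    laplacian_eq_fderiv_fderiv m, h2, h1]
  simp only [add_apply, smul_apply, ContinuousLinearMap.smulRight_apply, smul_eq_mul]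
  ring

end Summit.SmoothPoincare4.SmoothPoincare4.Theorems.HyperbolicEnd.Negative

end
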